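import Summits.CriticalPhenomena.PercolationContinuityZ3.Theorems.PercNearOneGluingNoHeavyLowerTailSmallBlockTransfer
import Summits.CriticalPhenomena.PercolationContinuityZ3.Theorems.PercNearOneGluingNoHeavyLowerTailCILSharpHardnessHub
import Literature.Probability.Percolation.FoldingFibresHarris
import HarnessLib

/-!
# `NoHeavyLowerTail` (stmt-CriticalPhenomena-4575) — CALIBRATION: the SHARP cumulative isolation
# inequality implies Kozma–Nitzan's pre-FKG Conjecture 2 (and Conjecture 1), by the hub transfer

Seat `prim-gen-swap` (gen 1), 2026-08-18.  `μ = prodBernoulli w` on `Fin n`, relays `A`, level `j`,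
`π(v) = {z ∈ A : v ↔ z}`, `R_v = {|π(v)| ≤ j}`.  The SHARP cumulative isolation inequality

  `CIL♯ :  μ(o ↔ A, |π(o)| ≤ j) ≤ μ(o ↔ A, |π(c)| ≤ j)`   for `o ∉ A` and a champion `c ∈ argmax_A μ(R_·)`

is the `W = A` instance of the small-block transfer `(T)` of `…SmallBlockTransfer.lean` (hypothesis `hT` of
`noHeavyLowerTail_of_smallBlockTransfer`), the "cluster-size transfer" CST of the `prim-cplus-engine` seat, and
Kozma–Nitzan's Conjecture 4 [KozmaNitzan2024, §5.1 p. 32] for the monotone cluster property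
`f(v) = 1{|C(v) ∩ A| > j}` with `A` both the target and the counting set.  It implies CIL and the crux.

**This file proves that CIL♯ (for all finite weighted graphs, relay sets and levels) implies Kozma–Nitzan's
Conjecture 2** [KozmaNitzan2024, (2) p. 3: `P(0 ↔ b) ≥ min_{a∈A} P(0 ↔ A, a ↔ b)`] **and hence Conjecture 1**
(`P(0 ↔ b) ≥ P(0 ↔ A)·min_a P(a ↔ b)`, the summit's registered strong hypothesis `KozmaNitzan2024_conjecture1`,
which gives `θ(p_c) = 0` on every `ℤ^d` by KN Thm 6) — so CIL♯, (T), CST and the top-weighted fractional forms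
are NOT intermediate lemmas but statements at least as strong as the open pre-FKG conjecture, whereas plain CIL
(registered `stub_cumulativeIsolation`) only transfers to the additive route item `AdditiveGluing`
(`additiveGluing_of_stub_cumulativeIsolation`, landed).

HUB TRANSFER (the device of [KozmaNitzan2024, Thm 10 proof sketch, p. 32]): given `(G, A, o, b)` on `Fin n`,
add `k = |A| + 1` new vertices `h₁,…,h_k` (the graph on `Fin (n + k)`), each joined to `b` by an edge of weight
`1` and to nothing else, take the relay set `A' = A ∪ {h_i}` and the level `j = |A|`.  Almost surely
`|π_{A'}(v)| ≤ j ⟺ v ↮ b`, the champion of `A'` is the relay `a₀ ∈ A` least connected to `b`, and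
`{o ↔ A'} = {o ↔ A} ∪ {o ↔ b}`; CIL♯ for `(A', j)` then reads `μ(o ↔ A, a₀ ↔ b) ≤ μ(o ↔ b)` — Conjecture 2 —
and Harris gives Conjecture 1.

* the hub graph on `Fin (n + k)` (old vertices `Fin.castAdd k`, hubs `Fin.natAdd n`), its almost-sure structure,
  the projection of open paths and the marginal live in `…CILSharpHardnessHub.lean` (namespace `CILSharpHardness`);
* `kozmaNitzan_conjecture2_of_cilSharp`, `kozmaNitzan_conjecture1_of_cilSharp` — the transfers;
* `kozmaNitzan_conjecture1_of_smallBlockTransfer` — the same for the hypothesis `hT` (shape of `(T)`).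
-/

noncomputable section

namespace Summit.CriticalPhenomena.PercolationContinuityZ3.Theorems

open MeasureTheory Set Literature.Probability.LatticeModels Literature.Probability.Percolation
open scoped Classical BigOperators

open CILSharpHardness

/-- **CIL♯ ⇒ Kozma–Nitzan Conjecture 2** (pre-FKG, form (2) of [KozmaNitzan2024, p. 3]):
if the sharp cumulative isolation inequality holds on every finite weighted graph, for every relay set and
level, then for every `(G, A, o, b)` with `A` nonempty there is `a ∈ A` with
`μ(o ↔ A, a ↔ b) ≤ μ(o ↔ b)` — by the hub transfer (module docstring). -/
theorem kozmaNitzan_conjecture2_of_cilSharp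
    (hS : ∀ (n : ℕ) (w : Sym2 (Fin n) → unitInterval) (A : Finset (Fin n)) (o c : Fin n) (j : ℕ),
      o ∉ A → c ∈ A →
      (∀ a ∈ A,
        (Literature.Probability.LatticeModels.prodBernoulli w).real
            {ω : Literature.Probability.Percolation.BondConfig (Fin n) |
              (A.filter fun z => ω ∈ Literature.Probability.Percolation.openConn a z).card ≤ j} ≤
          (Literature.Probability.LatticeModels.prodBernoulli w).real
            {ω : Literature.Probability.Percolation.BondConfig (Fin n) |
              (A.filter fun z => ω ∈ Literature.Probability.Percolation.openConn c z).card ≤ j}) →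
      (Literature.Probability.LatticeModels.prodBernoulli w).real
          {ω : Literature.Probability.Percolation.BondConfig (Fin n) |
            (∃ b ∈ A, ω ∈ Literature.Probability.Percolation.openConn o b) ∧
            (A.filter fun z => ω ∈ Literature.Probability.Percolation.openConn o z).card ≤ j} ≤
        (Literature.Probability.LatticeModels.prodBernoulli w).real
          {ω : Literature.Probability.Percolation.BondConfig (Fin n) |
            (∃ b ∈ A, ω ∈ Literature.Probability.Percolation.openConn o b) ∧
            (A.filter fun z => ω ∈ Literature.Probability.Percolation.openConn c z).card ≤ j}) :
    ∀ (n : ℕ) (w : Sym2 (Fin n) → unitInterval) (A : Finset (Fin n)) (o b : Fin n), A.Nonempty →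
      ∃ a ∈ A, (prodBernoulli w).real ((⋃ a' ∈ A, openConn o a') ∩ openConn a b) ≤
        (prodBernoulli w).real (openConn o b) := by
  intro n w A o b hA
  set μ := prodBernoulli w with hμ
  have hmeas : ∀ S : Set (BondConfig (Fin n)), MeasurableSet S := fun S => (Set.toFinite S).measurableSet
  -- trivial case `o ∈ A`
  by_cases hoA : o ∈ A
  · exact ⟨o, hoA, measureReal_mono inter_subset_right⟩
  -- the relay least connected to `b`
  obtain ⟨a₀, ha₀, hmax⟩ := Finset.exists_max_image A (fun a => μ.real (openConn a b : Set (BondConfig (Fin n)))ᶜ) hA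
  refine ⟨a₀, ha₀, ?_⟩
  -- the hub graph
  set k : ℕ := A.card + 1 with hk
  obtain ⟨w', hw, h1, h0⟩ := exists_hubWeight w b k
  set μ' := prodBernoulli w' with hμ'
  set A' : Finset (Fin (n + k)) := (A.map ⟨Fin.castAdd k, Fin.castAdd_injective _ _⟩ ∪
      (Finset.univ : Finset (Fin k)).map ⟨Fin.natAdd n, Fin.natAdd_injective _ _⟩) with hA'
  have transport := real_eq_of_good w b k w' hw h1 h0
  -- CIL♯ on the hub graph with `o' = o`, `c = a₀`, `j = |A|`
  have hoA' : Fin.castAdd k o ∉ A' := by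
    rw [hA', mem_relays'_iff]
    rintro (⟨a, ha, hao⟩ | ⟨i, hi⟩)
    · exact hoA (Fin.castAdd_injective _ _ hao ▸ ha)
    · exact castAdd_ne_natAdd o i hi.symm
  have ha₀A' : Fin.castAdd k a₀ ∈ A' := (mem_relays'_iff A _).2 (Or.inl ⟨a₀, ha₀, rfl⟩)
  -- loneliness events on the hub graph, transported
  have hR : ∀ v : Fin n, μ'.real {ω' : BondConfig (Fin (n + k)) |
      (A'.filter fun z => ω' ∈ openConn (Fin.castAdd k v) z).card ≤ A.card} =
      μ.real (openConn v b : Set (BondConfig (Fin n)))ᶜ := by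
    intro v
    refine transport _ _ fun ω' hω => ?_
    rw [mem_setOf_eq, card_filter_relays' hω A v, mem_compl_iff]
    constructor
    · intro h hvb
      rw [if_pos hvb] at h
      omega
    · intro hvb
      rw [if_neg hvb, add_zero]
      exact Finset.card_filter_le _ _
  have hRhub : ∀ i : Fin k, μ'.real {ω' : BondConfig (Fin (n + k)) |
      (A'.filter fun z => ω' ∈ openConn (Fin.natAdd n i) z).card ≤ A.card} = 0 := by
    intro i
    rw [transport _ (∅ : Set (BondConfig (Fin n))) fun ω' hω => ?_, measureReal_empty]
    simp only [mem_setOf_eq, mem_empty_iff_false, iff_false, not_le]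
    have := card_filter_relays'_natAdd hω A i
    rw [← hA'] at this
    omega
  have hchamp : ∀ z ∈ A', μ'.real {ω' : BondConfig (Fin (n + k)) |
      (A'.filter fun z' => ω' ∈ openConn z z').card ≤ A.card} ≤
      μ'.real {ω' : BondConfig (Fin (n + k)) |
        (A'.filter fun z' => ω' ∈ openConn (Fin.castAdd k a₀) z').card ≤ A.card} := by
    intro z hz
    rw [hR a₀]
    rcases (mem_relays'_iff A z).1 hz with ⟨a, ha, rfl⟩ | ⟨i, rfl⟩
    · rw [hR a]; exact hmax a ha
    · rw [hRhub i]; exact measureReal_nonneg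
  have key := hS (n + k) w' A' (Fin.castAdd k o) (Fin.castAdd k a₀) A.card hoA' ha₀A' hchamp
  -- identify the two sides
  set U : Set (BondConfig (Fin n)) := ⋃ a' ∈ A, openConn o a' with hU
  set B₀ : Set (BondConfig (Fin n)) := openConn o b with hB₀
  set Ca : Set (BondConfig (Fin n)) := openConn a₀ b with hCa
  have hreach : ∀ ω', ((∀ i : Fin k, s(Fin.castAdd k b, Fin.natAdd n i) ∈ ω') ∧
      ∀ e' ∈ ω', (∃ e : Sym2 (Fin n), Sym2.map (Fin.castAdd k) e = e') ∨
        ∃ i : Fin k, e' = s(Fin.castAdd k b, Fin.natAdd n i)) →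
      ((∃ z ∈ A', ω' ∈ openConn (Fin.castAdd k o) z) ↔
      restrictConfig (Fin.castAdd k) ω' ∈ U ∪ B₀) := by
    intro ω' hω
    rw [hU, hB₀, mem_union, mem_iUnion₂]
    constructor
    · rintro ⟨z, hz, hoz⟩
      rcases (mem_relays'_iff A z).1 hz with ⟨a, ha, rfl⟩ | ⟨i, rfl⟩
      · exact Or.inl ⟨a, ha, (reachable_castAdd_iff hω o a).1 hoz⟩
      · exact Or.inr ((reachable_natAdd_iff hω o i).1 hoz)
    · rintro (⟨a, ha, hoa⟩ | hob)
      · exact ⟨Fin.castAdd k a, (mem_relays'_iff A _).2 (Or.inl ⟨a, ha, rfl⟩),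
          (reachable_castAdd_iff hω o a).2 hoa⟩
      · have hk1 : 0 < k := by rw [hk]; omega
        exact ⟨Fin.natAdd n ⟨0, hk1⟩, (mem_relays'_iff A _).2 (Or.inr ⟨⟨0, hk1⟩, rfl⟩),
          (reachable_natAdd_iff hω o ⟨0, hk1⟩).2 hob⟩
  have hL : μ'.real {ω' : BondConfig (Fin (n + k)) |
      (∃ z ∈ A', ω' ∈ openConn (Fin.castAdd k o) z) ∧
      (A'.filter fun z => ω' ∈ openConn (Fin.castAdd k o) z).card ≤ A.card} = μ.real ((U ∪ B₀) \ B₀) := by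
    refine transport _ _ fun ω' hω => ?_
    rw [mem_setOf_eq, hreach ω' hω, Set.mem_sdiff, card_filter_relays' hω A o, and_congr_right_iff]
    intro _
    rw [hB₀]
    constructor
    · intro h hob
      rw [if_pos hob] at h
      omega
    · intro hob
      rw [if_neg hob, add_zero]
      exact Finset.card_filter_le _ _
  have hRc : μ'.real {ω' : BondConfig (Fin (n + k)) |
      (∃ z ∈ A', ω' ∈ openConn (Fin.castAdd k o) z) ∧
      (A'.filter fun z => ω' ∈ openConn (Fin.castAdd k a₀) z).card ≤ A.card} = μ.real ((U ∪ B₀) \ Ca) := by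
    refine transport _ _ fun ω' hω => ?_
    rw [mem_setOf_eq, hreach ω' hω, Set.mem_sdiff, card_filter_relays' hω A a₀, and_congr_right_iff]
    intro _
    rw [hCa]
    constructor
    · intro h hab
      rw [if_pos hab] at h
      omega
    · intro hab
      rw [if_neg hab, add_zero]
      exact Finset.card_filter_le _ _
  rw [hL, hRc] at key
  -- bookkeeping: μ((U ∪ B₀) \ B₀) = μ(U) - μ(U ∩ B₀), μ((U ∪ B₀) \ Ca) ≤ μ(U) - μ(U ∩ Ca) + μ(B₀ \ U)
  have e1 : (U ∪ B₀) \ B₀ = U \ B₀ := by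
    ext ω; simp only [Set.mem_sdiff, mem_union]; tauto
  have e2 : (U ∪ B₀) \ Ca ⊆ (U \ Ca) ∪ (B₀ \ U) := by
    intro ω; simp only [Set.mem_sdiff, mem_union]; tauto
  have s1 : μ.real (U ∩ B₀) + μ.real (U \ B₀) = μ.real U :=
    measureReal_inter_add_sdiff (hmeas B₀) (measure_ne_top _ _)
  have s2 : μ.real (U ∩ Ca) + μ.real (U \ Ca) = μ.real U :=
    measureReal_inter_add_sdiff (hmeas Ca) (measure_ne_top _ _)
  have s3 : μ.real (B₀ ∩ U) + μ.real (B₀ \ U) = μ.real B₀ :=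
    measureReal_inter_add_sdiff (hmeas U) (measure_ne_top _ _)
  have m2 : μ.real ((U ∪ B₀) \ Ca) ≤ μ.real (U \ Ca) + μ.real (B₀ \ U) :=
    (measureReal_mono e2).trans (measureReal_union_le _ _)
  rw [e1] at key
  rw [inter_comm] at s3
  linarith

/-- **CIL♯ ⇒ Kozma–Nitzan Conjecture 1** (the post-FKG conjecture `P(0 ↔ b) ≥ P(0 ↔ A)·min_a P(a ↔ b)`,
in the min-free typing of the summit's strong hypothesis `KozmaNitzan2024_conjecture1`): from
`kozmaNitzan_conjecture2_of_cilSharp` and Harris' inequality. -/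
theorem kozmaNitzan_conjecture1_of_cilSharp
    (hS : ∀ (n : ℕ) (w : Sym2 (Fin n) → unitInterval) (A : Finset (Fin n)) (o c : Fin n) (j : ℕ),
      o ∉ A → c ∈ A →
      (∀ a ∈ A,
        (Literature.Probability.LatticeModels.prodBernoulli w).real
            {ω : Literature.Probability.Percolation.BondConfig (Fin n) |
              (A.filter fun z => ω ∈ Literature.Probability.Percolation.openConn a z).card ≤ j} ≤
          (Literature.Probability.LatticeModels.prodBernoulli w).real
            {ω : Literature.Probability.Percolation.BondConfig (Fin n) |
              (A.filter fun z => ω ∈ Literature.Probability.Percolation.openConn c z).card ≤ j}) →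
      (Literature.Probability.LatticeModels.prodBernoulli w).real
          {ω : Literature.Probability.Percolation.BondConfig (Fin n) |
            (∃ b ∈ A, ω ∈ Literature.Probability.Percolation.openConn o b) ∧
            (A.filter fun z => ω ∈ Literature.Probability.Percolation.openConn o z).card ≤ j} ≤
        (Literature.Probability.LatticeModels.prodBernoulli w).real
          {ω : Literature.Probability.Percolation.BondConfig (Fin n) |
            (∃ b ∈ A, ω ∈ Literature.Probability.Percolation.openConn o b) ∧
            (A.filter fun z => ω ∈ Literature.Probability.Percolation.openConn c z).card ≤ j}) :
    ∀ (n : ℕ) (w : Sym2 (Fin n) → unitInterval) (A : Finset (Fin n)) (o b : Fin n) (t : ℝ),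
      (∀ a ∈ A, t ≤ (prodBernoulli w).real (openConn a b)) →
        (prodBernoulli w).real (⋃ a ∈ A, openConn o a) * t ≤ (prodBernoulli w).real (openConn o b) := by
  intro n w A o b t ht
  set μ := prodBernoulli w with hμ
  rcases A.eq_empty_or_nonempty with hA | hA
  · subst hA
    simp only [Finset.notMem_empty, iUnion_of_empty, iUnion_empty, measureReal_empty, zero_mul]
    exact measureReal_nonneg
  by_cases ht0 : t < 0
  · exact le_trans (mul_nonpos_of_nonneg_of_nonpos measureReal_nonneg ht0.le) measureReal_nonneg
  push Not at ht0
  obtain ⟨a, ha, hle⟩ := kozmaNitzan_conjecture2_of_cilSharp hS n w A o b hA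
  have hU : IsUpperSet (⋃ a' ∈ A, (openConn o a' : Set (BondConfig (Fin n)))) :=
    isUpperSet_iUnion₂ fun a' _ => isUpperSet_openConn o a'
  have harris := prodBernoulli_harris_via_fibres w hU (isUpperSet_openConn a b)
  calc μ.real (⋃ a' ∈ A, openConn o a') * t
      ≤ μ.real (⋃ a' ∈ A, openConn o a') * μ.real (openConn a b) :=
        mul_le_mul_of_nonneg_left (ht a ha) measureReal_nonneg
    _ ≤ μ.real ((⋃ a' ∈ A, openConn o a') ∩ openConn a b) := harris
    _ ≤ μ.real (openConn o b) := hle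

/-- **The small-block transfer hypothesis `(T)` (shape of `stub_smallBlockTransfer`, hypothesis `hT` of
`noHeavyLowerTail_of_smallBlockTransfer`) implies Kozma–Nitzan's Conjecture 1**: its `W = A` instance is CIL♯. -/
theorem kozmaNitzan_conjecture1_of_smallBlockTransfer
    (hT : ∀ (n : ℕ) (w : Sym2 (Fin n) → unitInterval) (A W : Finset (Fin n)) (o a : Fin n) (j : ℕ),
      W ⊆ A → o ∉ A → a ∈ A →
      (∀ b ∈ W,
        (Literature.Probability.LatticeModels.prodBernoulli w).real
            {ω : Literature.Probability.Percolation.BondConfig (Fin n) |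
              (A.filter fun z => ω ∈ Literature.Probability.Percolation.openConn b z).card ≤ j} ≤
          (Literature.Probability.LatticeModels.prodBernoulli w).real
            {ω : Literature.Probability.Percolation.BondConfig (Fin n) |
              (A.filter fun z => ω ∈ Literature.Probability.Percolation.openConn a z).card ≤ j}) →
      (Literature.Probability.LatticeModels.prodBernoulli w).real
          {ω : Literature.Probability.Percolation.BondConfig (Fin n) |
            (∃ b ∈ W, ω ∈ Literature.Probability.Percolation.openConn o b) ∧
            (A.filter fun z => ω ∈ Literature.Probability.Percolation.openConn o z).card ≤ j} ≤
        (Literature.Probability.LatticeModels.prodBernoulli w).real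
          {ω : Literature.Probability.Percolation.BondConfig (Fin n) |
            (∃ b ∈ W, ω ∈ Literature.Probability.Percolation.openConn o b) ∧
            (A.filter fun z => ω ∈ Literature.Probability.Percolation.openConn a z).card ≤ j}) :
    ∀ (n : ℕ) (w : Sym2 (Fin n) → unitInterval) (A : Finset (Fin n)) (o b : Fin n) (t : ℝ),
      (∀ a ∈ A, t ≤ (prodBernoulli w).real (openConn a b)) →
        (prodBernoulli w).real (⋃ a ∈ A, openConn o a) * t ≤ (prodBernoulli w).real (openConn o b) :=
  kozmaNitzan_conjecture1_of_cilSharp fun n w A o c j ho hc hmax => hT n w A A o c j (subset_refl A) ho hc hmax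

end Summit.CriticalPhenomena.PercolationContinuityZ3.Theorems

end
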